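import Summits.KontsevichZagierPeriods.KontsevichZagierPeriods.Theses.TerasomaMultiplication

/-!
# `DasGapTwelve` (stmt-KontsevichZagierPeriods-13215, route TerasomaMultiplication) — line
`picard-involution-quotient` (lead skeleton)

The crux: `[∫_(0,1) x^(−11/12)(1−x)^(−3/4)] ~ [∫_(0,1) c₀·x^(−3/4)(1−x)^(−3/4)]`,
`c₀ = 2^(−1/4)·3^(3/8)·√(1+√3)` (`B(1/12,1/4) = c₀·B(1/4,1/4)`), as a `KZ.Equivalent` statement.

Line (idea card `Cruxes/DasGapTwelve/Ideas/picard-involution-quotient.md`): `x = t³` puts the left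
side on the Picard curve `v⁴ = t − t⁴` (`X⁴ = Y³ − 1`, automorphism group of order 48); the real
involution `τ₊ : t ↦ (1−t)/(1+2t)` folds away the `τ₊`-anti-invariant part of `3(t−t⁴)^(−3/4)dt`
(stub F); the quotient by the companion involution `τ₋` is the elliptic curve `V² = w³ − (3+2√3)w`
(`w² = (1+t+t²)/(t(1−t))`), a quartic twist of `y² = x³ − x`, onto whose unbounded real component the
arc `(0,1)` folds `2:1` (stub Q); untwisting (`x = √D·y`, `y = 1/s²`, stub T) and the lemniscatic
normalisation of `B(1/4,1/4)` (stub B) land both sides on `[(0,1), 4√2·c₀(1−s⁴)^(−1/2)]`.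
Rules 1a/1b/2 only, dimension one throughout. The five stubs are registered on the item
(`ledger skeleton check`); `DasGapTwelve_of` is their composition by `KZ.Equivalent.trans/symm`.
-/

noncomputable section

open Set MeasureTheory

namespace Summit.KontsevichZagierPeriods.TerasomaMultiplication.DasGapTwelve

open Literature.NumberTheory.Transcendental
open Summit.KontsevichZagierPeriods.KontsevichZagierPeriods.Theses.TerasomaMultiplication (DasGapTwelve)

/-- Stub E (entry substitution `x = t³`, one rule-2 move): the crux's left representation
`[(0,1), x^(-11/12)(1-x)^(-3/4)]` is equivalent to `[(0,1), 3(t − t⁴)^(−3/4)]`, a period of the quartic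
`v⁴ = t − t⁴` (the Picard curve `X⁴ = Y³ − 1`), and such a representation exists. [folklore] -/
theorem stub_cubeSubstitution :
    ∀ (r : Literature.NumberTheory.Transcendental.KZ.IntegralRep 1), r.domain = {x | x 0 ∈ Set.Ioo (0:ℝ) 1} → Set.EqOn r.integrand (fun x => (x 0) ^ (-(11:ℝ)/12) * (1 - x 0) ^ (-(3:ℝ)/4)) r.domain → (∃ ρ : Literature.NumberTheory.Transcendental.KZ.IntegralRep 1, ρ.domain = {x | x 0 ∈ Set.Ioo (0:ℝ) 1} ∧ Set.EqOn ρ.integrand (fun x => 3 * (x 0 - (x 0) ^ 4) ^ (-(3:ℝ)/4)) ρ.domain) ∧ ∀ (ρ : Literature.NumberTheory.Transcendental.KZ.IntegralRep 1), ρ.domain = {x | x 0 ∈ Set.Ioo (0:ℝ) 1} → Set.EqOn ρ.integrand (fun x => 3 * (x 0 - (x 0) ^ 4) ^ (-(3:ℝ)/4)) ρ.domain → Literature.NumberTheory.Transcendental.KZ.Equivalent r ρ := by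
  sorry

/-- Stub F (the fold by the real involution `t ↦ (1−t)/(1+2t)` of `v⁴ = t − t⁴`): since
`3 = √3(t + (1+√3)/2) − √3(t + (1−√3)/2)` and `[(0,1), (t + (1−√3)/2)(t−t⁴)^(−3/4)]` is a relation
(split at `t* = (√3−1)/2`, rule 2 by the involution, rule 1b), `[(0,1), 3(t−t⁴)^(−3/4)]` is equivalent
to `[(0,1), √3(t + (1+√3)/2)(t−t⁴)^(−3/4)]`. [folklore] -/
theorem stub_involutionFold :
    ∀ (ρ₁ : Literature.NumberTheory.Transcendental.KZ.IntegralRep 1), ρ₁.domain = {x | x 0 ∈ Set.Ioo (0:ℝ) 1} → Set.EqOn ρ₁.integrand (fun x => 3 * (x 0 - (x 0) ^ 4) ^ (-(3:ℝ)/4)) ρ₁.domain → (∃ ρ₂ : Literature.NumberTheory.Transcendental.KZ.IntegralRep 1, ρ₂.domain = {x | x 0 ∈ Set.Ioo (0:ℝ) 1} ∧ Set.EqOn ρ₂.integrand (fun x => Real.sqrt 3 * (x 0 + (1 + Real.sqrt 3) / 2) * (x 0 - (x 0) ^ 4) ^ (-(3:ℝ)/4)) ρ₂.domain) ∧ ∀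 (ρ₂ : Literature.NumberTheory.Transcendental.KZ.IntegralRep 1), ρ₂.domain = {x | x 0 ∈ Set.Ioo (0:ℝ) 1} → Set.EqOn ρ₂.integrand (fun x => Real.sqrt 3 * (x 0 + (1 + Real.sqrt 3) / 2) * (x 0 - (x 0) ^ 4) ^ (-(3:ℝ)/4)) ρ₂.domain → Literature.NumberTheory.Transcendental.KZ.Equivalent ρ₁ ρ₂ := by
  sorry

/-- Stub Q (HARDEST; quotient by the companion involution `τ₋`): with `D = 3 + 2√3` and
`w(t) = √((1+t+t²)/(t(1−t)))`, which maps each of `(0,t*)`, `(t*,1)` monotonically onto `(√D, ∞)` with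
`(t + (1+√3)/2)(t−t⁴)^(−3/4) = (√3+1)·|w′(t)|·(w³ − D w)^(−1/2)`, two rule-2 moves and rule 1a/1b give
`[(0,1), √3(t + (1+√3)/2)(t−t⁴)^(−3/4)] ~ [(√D,∞), 2√3(√3+1)(x³ − D x)^(−1/2)]`. [folklore] -/
theorem stub_involutionQuotient :
    ∀ (ρ₂ : Literature.NumberTheory.Transcendental.KZ.IntegralRep 1), ρ₂.domain = {x | x 0 ∈ Set.Ioo (0:ℝ) 1} → Set.EqOn ρ₂.integrand (fun x => Real.sqrt 3 * (x 0 + (1 + Real.sqrt 3) / 2) * (x 0 - (x 0) ^ 4) ^ (-(3:ℝ)/4)) ρ₂.domain → (∃ ρ₃ : Literature.NumberTheory.Transcendental.KZ.IntegralRep 1, ρ₃.domain = {x | Real.sqrt (3 + 2 * Real.sqrt 3) < x 0} ∧ Set.EqOn ρ₃.integrand (fun x => 2 * Real.sqrt 3 * (Real.sqrt 3 + 1) * ((x 0) ^ 3 - (3 + 2 * Real.sqrt 3) * x 0) ^ (-(1:ℝ)/2)) ρ₃.domain) ∧ ∀ (ρ₃ : Literature.NumberTheory.Transcendental.KZ.IntegralRep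 1), ρ₃.domain = {x | Real.sqrt (3 + 2 * Real.sqrt 3) < x 0} → Set.EqOn ρ₃.integrand (fun x => 2 * Real.sqrt 3 * (Real.sqrt 3 + 1) * ((x 0) ^ 3 - (3 + 2 * Real.sqrt 3) * x 0) ^ (-(1:ℝ)/2)) ρ₃.domain → Literature.NumberTheory.Transcendental.KZ.Equivalent ρ₂ ρ₃ := by
  sorry

/-- Stub T (untwisting the `j = 1728` quartic twist `V² = w³ − D w`): the scalings `x = √D·y`,
`y = 1/s²` (two rule-2 moves) and the exact constant identity `4√3(√3+1)D^(−1/4) = 4√2·c₀` give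
`[(√D,∞), 2√3(√3+1)(x³ − D x)^(−1/2)] ~ [(0,1), 4√2·c₀·(1 − s⁴)^(−1/2)]`. [folklore] -/
theorem stub_twistNormalisation :
    ∀ (ρ₃ : Literature.NumberTheory.Transcendental.KZ.IntegralRep 1), ρ₃.domain = {x | Real.sqrt (3 + 2 * Real.sqrt 3) < x 0} → Set.EqOn ρ₃.integrand (fun x => 2 * Real.sqrt 3 * (Real.sqrt 3 + 1) * ((x 0) ^ 3 - (3 + 2 * Real.sqrt 3) * x 0) ^ (-(1:ℝ)/2)) ρ₃.domain → (∃ ρ₄ : Literature.NumberTheory.Transcendental.KZ.IntegralRep 1, ρ₄.domain = {x | x 0 ∈ Set.Ioo (0:ℝ) 1} ∧ Set.EqOn ρ₄.integrand (fun x => 4 * Real.sqrt 2 * ((2:ℝ) ^ (-(1:ℝ)/4) * (3:ℝ) ^ ((3:ℝ)/8) * Real.sqrt (1 + Real.sqrt 3)) * (1 - (x 0) ^ 4) ^ (-(1:ℝ)/2)) ρ₄.domain) ∧ ∀ (ρ₄ : Literature.NumberTheory.Transcendental.KZ.IntegralRep 1), ρ₄.domain = {x | x 0 ∈ Set.Ioo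 (0:ℝ) 1} → Set.EqOn ρ₄.integrand (fun x => 4 * Real.sqrt 2 * ((2:ℝ) ^ (-(1:ℝ)/4) * (3:ℝ) ^ ((3:ℝ)/8) * Real.sqrt (1 + Real.sqrt 3)) * (1 - (x 0) ^ 4) ^ (-(1:ℝ)/2)) ρ₄.domain → Literature.NumberTheory.Transcendental.KZ.Equivalent ρ₃ ρ₄ := by
  sorry

/-- Stub B (lemniscatic normalisation of `B(1/4,1/4)`): split `(0,1)` at `1/2`, fold `t ↦ 1−t`,
substitute `t = (1 − √(1−s⁴))/2` (so `t(1−t) = s⁴/4`): the crux's right representation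
`[(0,1), c₀ t^(−3/4)(1−t)^(−3/4)]` is equivalent to `[(0,1), 4√2·c₀·(1−s⁴)^(−1/2)]`. [folklore] -/
theorem stub_lemniscaticBeta :
    ∀ (r' : Literature.NumberTheory.Transcendental.KZ.IntegralRep 1), r'.domain = {x | x 0 ∈ Set.Ioo (0:ℝ) 1} → Set.EqOn r'.integrand (fun x => (2:ℝ) ^ (-(1:ℝ)/4) * (3:ℝ) ^ ((3:ℝ)/8) * Real.sqrt (1 + Real.sqrt 3) * (x 0) ^ (-(3:ℝ)/4) * (1 - x 0) ^ (-(3:ℝ)/4)) r'.domain → ∀ (ρ₄ : Literature.NumberTheory.Transcendental.KZ.IntegralRep 1), ρ₄.domain = {x | x 0 ∈ Set.Ioo (0:ℝ) 1} → Set.EqOn ρ₄.integrand (fun x => 4 * Real.sqrt 2 * ((2:ℝ) ^ (-(1:ℝ)/4) * (3:ℝ) ^ ((3:ℝ)/8) * Real.sqrt (1 + Real.sqrt 3)) * (1 - (x 0) ^ 4) ^ (-(1:ℝ)/2)) ρ₄.domain → Literature.NumberTheory.Transcendental.KZ.Equivalent r' ρ₄ := by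
  sorry

/-- **The line closes the crux** (composition of the five stubs): `r ~ ρ₁ ~ ρ₂ ~ ρ₃ ~ ρ₄ ~ r'`
by `KZ.Equivalent.trans` / `KZ.Equivalent.symm`, the intermediate representations being supplied by
the existence halves of stubs E, F, Q, T. [folklore] -/
theorem DasGapTwelve_of : DasGapTwelve := by
  intro r r' hr hri hr' hri'
  obtain ⟨⟨ρ₁, hρ₁, hρ₁i⟩, hE⟩ := stub_cubeSubstitution r hr hri
  obtain ⟨⟨ρ₂, hρ₂, hρ₂i⟩, hF⟩ := stub_involutionFold ρ₁ hρ₁ hρ₁i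
  obtain ⟨⟨ρ₃, hρ₃, hρ₃i⟩, hQ⟩ := stub_involutionQuotient ρ₂ hρ₂ hρ₂i
  obtain ⟨⟨ρ₄, hρ₄, hρ₄i⟩, hT⟩ := stub_twistNormalisation ρ₃ hρ₃ hρ₃i
  have hB := stub_lemniscaticBeta r' hr' hri' ρ₄ hρ₄ hρ₄i
  exact ((((hE ρ₁ hρ₁ hρ₁i).trans (hF ρ₂ hρ₂ hρ₂i)).trans (hQ ρ₃ hρ₃ hρ₃i)).trans
    (hT ρ₄ hρ₄ hρ₄i)).trans hB.symm

end Summit.KontsevichZagierPeriods.TerasomaMultiplication.DasGapTwelve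

end
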